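import Mathlib
import Literature.NumberTheory.DiophantineGeometry.TernaryConicPointBoundPlane

/-!
# The auxiliary prime: first-order `p`-adic determinant method for a conic, and the class count

Auxiliary file (theorems only, no definitions) for the proof of **Heath-Brown's bound for primitive
zeros of a ternary quadratic form in a box** (`Literature.NumberTheory.DiophantineGeometry.
TernaryConicPointBound`, [Heathbrown2002, Cor. 2], discharged in `TernaryConicPointBoundProofs`).

This is the case `d = 2` of the determinant method of [Heathbrown2002, Thm 3 and §3] in its simplest
(first-order Taylor) form, as in `SquarefulSumsDetMethod` for diagonal forms:

* `TernaryConic.pow_three_dvd_det_of_cls`: for a symmetric `M` and a prime `p ∤ 2 det M`, three zeros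
  of `xᵀ M x` reducing to the same point of the (smooth) conic modulo `p` have determinant divisible
  by `p³` (two powers from the congruence, one from the tangent line modulo `p`);
* `TernaryConic.card_clsSet_le`: the classes `(i, v)` (`v i = 1`, `v` on the conic over `𝔽_p`,
  `p` odd, `det ≠ 0`) number at most `9p` (for each pivot and each value of one coordinate the
  dehomogenised equation is a non-trivial quadratic in the last coordinate, except for at most one
  degenerate value).

## References

* D. R. Heath-Brown, *The density of rational points on curves and surfaces*, Ann. of Math. 155
  (2002) 553–595, Theorem 3, §3 and Corollary 2 [Heathbrown2002].
-/

namespace Literature.NumberTheory.DiophantineGeometry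

namespace TernaryConic

open Finset Matrix

/-! ### Transport under coordinate permutations -/

/-- The quadratic data is invariant under a simultaneous permutation of coordinates. [folklore] -/
theorem comp_dot_submatrix_mulVec {R : Type*} [CommRing R] (M : Matrix (Fin 3) (Fin 3) R)
    (σ : Equiv.Perm (Fin 3)) (x y : Fin 3 → R) :
    (x ∘ σ) ⬝ᵥ (M.submatrix σ σ) *ᵥ (y ∘ σ) = x ⬝ᵥ M *ᵥ y := by
  simp only [dotProduct, Matrix.mulVec, Matrix.submatrix_apply, Function.comp_apply]
  have h1 : ∀ k, ∑ l, M (σ k) (σ l) * y (σ l) = ∑ l, M (σ k) l * y l := fun k =>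
    Equiv.sum_comp σ (fun l => M (σ k) l * y l)
  simp_rw [h1]
  exact Equiv.sum_comp σ (fun k => x k * ∑ l, M k l * y l)

/-- Precomposition with a permutation is injective on vectors. [folklore] -/
theorem comp_perm_injective' {R : Type*} (σ : Equiv.Perm (Fin 3)) :
    Function.Injective fun z : Fin 3 → R => z ∘ σ := by
  intro z w h
  funext i
  have := congrFun h (σ.symm i)
  simpa using this

/-! ### Three solutions in one class modulo the auxiliary prime -/

/-- **First-order `p`-adic determinant method for a conic**, pivot `0`. Let `M` be symmetric with
`p ∤ 2 det M`. If the rows of `X` are zeros of `xᵀ M x`, all congruent modulo `p` to (unit multiples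
of) the same vector `w` with `w 0 = 1`, then `p³ ∣ det X`: two powers of `p` come from the
congruence, the third from the tangent line of the smooth conic modulo `p`. (Compare
`SquarefulDet.pow_three_dvd_det_of_cls_zero` for diagonal forms; [Heathbrown2002, §3].)
[folklore] -/
theorem pow_three_dvd_det_of_cls_zero (M : Matrix (Fin 3) (Fin 3) ℤ) (hM : M.IsSymm) {p : ℤ}
    (hp : Prime p) (hp2 : ¬ p ∣ 2) (hpdet : ¬ p ∣ M.det) (w : Fin 3 → ℤ) (hw0 : w 0 = 1)
    (X : Matrix (Fin 3) (Fin 3) ℤ)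
    (hX1 : ∀ r, p ∣ X r 1 - X r 0 * w 1) (hX2 : ∀ r, p ∣ X r 2 - X r 0 * w 2)
    (hX0 : ∀ r, ¬ p ∣ X r 0) (hq : ∀ r, X r ⬝ᵥ M *ᵥ X r = 0) :
    p ^ 3 ∣ X.det := by
  choose u hu using hX1
  choose v hv using hX2
  have hu' : ∀ r, X r 1 = X r 0 * w 1 + p * u r := fun r => by linarith [hu r]
  have hv' : ∀ r, X r 2 = X r 0 * w 2 + p * v r := fun r => by linarith [hv r]
  obtain ⟨g, hg⟩ : ∃ g : Fin 3 → ℤ, M *ᵥ w = g := ⟨_, rfl⟩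
  -- the form along `w`
  have hdec : ∀ r, X r 0 * X r 0 * (w 0 * g 0 + w 1 * g 1 + w 2 * g 2) =
      -(p * (p * (M 1 1 * u r * u r + M 1 2 * (u r * v r + u r * v r) + M 2 2 * v r * v r)
        + 2 * X r 0 * (u r * g 1 + v r * g 2))) := by
    intro r
    have h1 := dot_mulVec_decomp M hM w (X r) (X r) 0 1 2 rfl rfl hw0
    rw [hq r, hg] at h1
    have e1 : X r 1 - w 1 * X r 0 = p * u r := by linarith [hu r]
    have e2 : X r 2 - w 2 * X r 0 = p * v r := by linarith [hv r]
    rw [e1, e2] at h1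
    linear_combination -h1
  -- `p ∣ q(w)`; write `q(w) = p τ`
  have hqw : p ∣ w 0 * g 0 + w 1 * g 1 + w 2 * g 2 := by
    have h1 : p ∣ X 0 0 * X 0 0 * (w 0 * g 0 + w 1 * g 1 + w 2 * g 2) := by
      rw [hdec 0]; exact (dvd_mul_right p _).neg_right
    rcases hp.dvd_or_dvd h1 with h2 | h2
    · rcases hp.dvd_or_dvd h2 with h3 | h3
      · exact absurd h3 (hX0 0)
      · exact absurd h3 (hX0 0)
    · exact h2
  obtain ⟨τ, hτ⟩ := hqw
  -- the linear condition modulo `p` in each row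
  have hlin : ∀ r, p ∣ X r 0 * τ + 2 * g 1 * u r + 2 * g 2 * v r := by
    intro r
    have h1 : p * (X r 0 * (X r 0 * τ + 2 * g 1 * u r + 2 * g 2 * v r)) =
        p * (-(p * (M 1 1 * u r * u r + M 1 2 * (u r * v r + u r * v r) + M 2 2 * v r * v r))) := by
      have := hdec r
      rw [hτ] at this
      linear_combination this
    have h2 := mul_left_cancel₀ hp.ne_zero h1
    have h3 : p ∣ X r 0 * (X r 0 * τ + 2 * g 1 * u r + 2 * g 2 * v r) := by
      rw [h2]; exact (dvd_mul_right p _).neg_right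
    rcases hp.dvd_or_dvd h3 with h4 | h4
    · exact absurd h4 (hX0 r)
    · exact h4
  choose s hs using hlin
  -- one of `g 1`, `g 2` is a unit modulo `p` (the conic is smooth modulo `p`)
  have hgu : ¬ p ∣ 2 * g 1 ∨ ¬ p ∣ 2 * g 2 := by
    by_contra h
    simp only [not_or, not_not] at h
    obtain ⟨h₁, h₂⟩ := h
    have hg1 : p ∣ g 1 := (hp.dvd_or_dvd h₁).resolve_left hp2
    have hg2 : p ∣ g 2 := (hp.dvd_or_dvd h₂).resolve_left hp2
    have hg0 : p ∣ g 0 := by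
      have h3 : p ∣ w 0 * g 0 + w 1 * g 1 + w 2 * g 2 := ⟨τ, hτ⟩
      rw [hw0, one_mul] at h3
      have h4 := dvd_sub (dvd_sub h3 (hg1.mul_left (w 1))) (hg2.mul_left (w 2))
      have : g 0 = g 0 + w 1 * g 1 + w 2 * g 2 - w 1 * g 1 - w 2 * g 2 := by ring
      rw [this]; exact h4
    have hall : ∀ k, p ∣ g k := by
      intro k; fin_cases k
      · exact hg0
      · exact hg1
      · exact hg2
    -- `adj(M) (M w) = det M • w`, first coordinate
    have h5 : M.adjugate *ᵥ (M *ᵥ w) = M.det • w := by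
      rw [Matrix.mulVec_mulVec, Matrix.adjugate_mul, Matrix.smul_mulVec, Matrix.one_mulVec]
    have h6 := congrFun h5 0
    simp only [Pi.smul_apply, smul_eq_mul, hw0, mul_one, hg] at h6
    apply hpdet
    rw [← h6]
    simp only [Matrix.mulVec, dotProduct, Fin.sum_univ_three]
    exact dvd_add (dvd_add ((hall 0).mul_left _) ((hall 1).mul_left _)) ((hall 2).mul_left _)
  have hdet : X.det = X 0 0 * (X 1 1 * X 2 2 - X 1 2 * X 2 1) - X 0 1 * (X 1 0 * X 2 2 - X 1 2 * X 2 0)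
      + X 0 2 * (X 1 0 * X 2 1 - X 1 1 * X 2 0) := by
    rw [Matrix.det_fin_three]; ring
  rcases hgu with hg' | hg'
  · -- expand along the `u` column
    have key : 2 * g 1 * X.det = p ^ 3 * (X 0 0 * (s 1 * v 2 - v 1 * s 2) - s 0 * (X 1 0 * v 2 - v 1 * X 2 0)
        + v 0 * (X 1 0 * s 2 - s 1 * X 2 0)) := by
      rw [hdet, hu' 0, hu' 1, hu' 2, hv' 0, hv' 1, hv' 2]
      linear_combination (p ^ 2 * (-(X 1 0 * v 2 - v 1 * X 2 0))) * hs 0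
        + (p ^ 2 * (X 0 0 * v 2 - v 0 * X 2 0)) * hs 1
        + (p ^ 2 * (-(X 0 0 * v 1 - v 0 * X 1 0))) * hs 2
    exact hp.pow_dvd_of_dvd_mul_left 3 hg' ⟨_, key⟩
  · -- expand along the `v` column
    have key : 2 * g 2 * X.det = p ^ 3 * (X 0 0 * (u 1 * s 2 - s 1 * u 2) - u 0 * (X 1 0 * s 2 - s 1 * X 2 0)
        + s 0 * (X 1 0 * u 2 - u 1 * X 2 0)) := by
      rw [hdet, hu' 0, hu' 1, hu' 2, hv' 0, hv' 1, hv' 2]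
      linear_combination (p ^ 2 * (X 1 0 * u 2 - u 1 * X 2 0)) * hs 0
        + (p ^ 2 * (-(X 0 0 * u 2 - u 0 * X 2 0))) * hs 1
        + (p ^ 2 * (X 0 0 * u 1 - u 0 * X 1 0)) * hs 2
    exact hp.pow_dvd_of_dvd_mul_left 3 hg' ⟨_, key⟩

/-- `pow_three_dvd_det_of_cls_zero` for an arbitrary pivot coordinate `i₀`. [folklore] -/
theorem pow_three_dvd_det_of_cls (M : Matrix (Fin 3) (Fin 3) ℤ) (hM : M.IsSymm) {p : ℤ}
    (hp : Prime p) (hp2 : ¬ p ∣ 2) (hpdet : ¬ p ∣ M.det) (w : Fin 3 → ℤ) (i₀ : Fin 3)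
    (hw0 : w i₀ = 1) (X : Matrix (Fin 3) (Fin 3) ℤ)
    (hX : ∀ r l, p ∣ X r l - X r i₀ * w l) (hX0 : ∀ r, ¬ p ∣ X r i₀)
    (hq : ∀ r, X r ⬝ᵥ M *ᵥ X r = 0) :
    p ^ 3 ∣ X.det := by
  set σ : Equiv.Perm (Fin 3) := Equiv.swap 0 i₀ with hσ
  have hσ0 : σ 0 = i₀ := by simp [hσ, Equiv.swap_apply_left]
  have h := pow_three_dvd_det_of_cls_zero (M.submatrix σ σ) (hM.submatrix σ) hp hp2
    (by rw [Matrix.det_submatrix_equiv_self]; exact hpdet) (w ∘ σ)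
    (by simpa [hσ0] using hw0) (X.submatrix id σ)
    (fun r => by simpa [Matrix.submatrix_apply, hσ0] using hX r (σ 1))
    (fun r => by simpa [Matrix.submatrix_apply, hσ0] using hX r (σ 2))
    (fun r => by simpa [Matrix.submatrix_apply, hσ0] using hX0 r)
    (fun r => by
      have : (X.submatrix id σ) r = X r ∘ σ := rfl
      rw [this, comp_dot_submatrix_mulVec]
      exact hq r)
  rw [Matrix.det_permute'] at h
  have hs : ((Equiv.Perm.sign σ : ℤˣ) : ℤ) * ((Equiv.Perm.sign σ : ℤˣ) : ℤ) = 1 := by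
    rw [← Units.val_mul, Int.units_mul_self, Units.val_one]
  have : X.det = ((Equiv.Perm.sign σ : ℤˣ) : ℤ) * (((Equiv.Perm.sign σ : ℤˣ) : ℤ) * X.det) := by
    rw [← mul_assoc, hs, one_mul]
  rw [this]
  exact h.mul_left _

/-! ### Counting classes modulo `p`: points of a smooth conic over `𝔽_p` -/

/-- A quadratic `c₂ t² + c₁ t + c₀`, not identically zero, has at most two roots in a field.
[folklore] -/
theorem card_quadratic_roots_le_two {F : Type*} [Field F] [DecidableEq F] (S : Finset F)
    (c₂ c₁ c₀ : F) (h : ¬ (c₂ = 0 ∧ c₁ = 0 ∧ c₀ = 0)) :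
    #(S.filter fun t => c₂ * t ^ 2 + c₁ * t + c₀ = 0) ≤ 2 := by
  by_contra hlt
  rw [not_le, Finset.two_lt_card_iff] at hlt
  obtain ⟨t1, t2, t3, h1, h2, h3, h12, h13, h23⟩ := hlt
  rw [Finset.mem_filter] at h1 h2 h3
  have hd : ∀ s t : F, c₂ * s ^ 2 + c₁ * s + c₀ = 0 → c₂ * t ^ 2 + c₁ * t + c₀ = 0 → s ≠ t →
      c₂ * (s + t) + c₁ = 0 := by
    intro s t hs ht hst
    have : (s - t) * (c₂ * (s + t) + c₁) = 0 := by linear_combination hs - ht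
    rcases mul_eq_zero.mp this with h4 | h4
    · exact absurd (sub_eq_zero.mp h4) hst
    · exact h4
  have e12 := hd t1 t2 h1.2 h2.2 h12
  have e13 := hd t1 t3 h1.2 h3.2 h13
  have hc2 : c₂ = 0 := by
    have : c₂ * (t2 - t3) = 0 := by linear_combination e12 - e13
    rcases mul_eq_zero.mp this with h4 | h4
    · exact h4
    · exact absurd (sub_eq_zero.mp h4) h23
  have hc1 : c₁ = 0 := by rw [hc2] at e12; linear_combination e12
  have hc0 : c₀ = 0 := by have := h1.2; rw [hc2, hc1] at this; linear_combination this
  exact h (⟨hc2, hc1, hc0⟩)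

/-- Points of the conic `vᵀ A v = 0` over `𝔽_p` (`p` odd, `det A ≠ 0`) with `v 0 = 1`: at most `3p`
(for each value of `v 1`, at most two values of `v 2`, except for at most one degenerate value).
[folklore] -/
theorem card_cls_zero_le {p : ℕ} [Fact p.Prime] (hp2 : p ≠ 2) (A : Matrix (Fin 3) (Fin 3) (ZMod p))
    (hA : A.IsSymm) (hdet : A.det ≠ 0) :
    #{v : Fin 3 → ZMod p | v 0 = 1 ∧ v ⬝ᵥ A *ᵥ v = 0} ≤ 3 * p := by
  classical
  have h2 : (2 : ZMod p) ≠ 0 := by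
    intro h
    have : ((2 : ℕ) : ZMod p) = 0 := by exact_mod_cast h
    rw [ZMod.natCast_eq_zero_iff] at this
    exact hp2 ((Nat.prime_dvd_prime_iff_eq Fact.out Nat.prime_two).mp this)
  have h10 : A 1 0 = A 0 1 := hA.apply 0 1
  have h20 : A 2 0 = A 0 2 := hA.apply 0 2
  have h21 : A 2 1 = A 1 2 := hA.apply 1 2
  set W := (Finset.univ.filter fun v : Fin 3 → ZMod p => v 0 = 1 ∧ v ⬝ᵥ A *ᵥ v = 0) with hW
  -- the dehomogenised equation `P(s, t) = 0`, quadratic in `t`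
  let c2 : ZMod p → ZMod p := fun _ => A 2 2
  let c1 : ZMod p → ZMod p := fun s => 2 * A 0 2 + 2 * A 1 2 * s
  let c0 : ZMod p → ZMod p := fun s => A 0 0 + 2 * A 0 1 * s + A 1 1 * s ^ 2
  let Tset : ZMod p → Finset (ZMod p) := fun s =>
    Finset.univ.filter fun t => c2 s * t ^ 2 + c1 s * t + c0 s = 0
  have hPW : ∀ v ∈ W, v 2 ∈ Tset (v 1) := by
    intro v hv
    rw [hW, Finset.mem_filter] at hv
    obtain ⟨-, hv0, hvq⟩ := hv
    simp only [Matrix.mulVec, dotProduct, Fin.sum_univ_three, hv0, h10, h20, h21] at hvq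
    simp only [Tset, c2, c1, c0, Finset.mem_filter, Finset.mem_univ, true_and]
    linear_combination hvq
  -- Step 1: `#W ≤ ∑_s #T(s)`
  have hstep1 : #W ≤ ∑ s, #(Tset s) := by
    have hsub : W ⊆ Finset.univ.biUnion fun s => (Tset s).image fun t => (![1, s, t] : Fin 3 → ZMod p) := by
      intro v hv
      have hv' := hv
      rw [hW, Finset.mem_filter] at hv'
      simp only [Finset.mem_biUnion, Finset.mem_univ, true_and, Finset.mem_image]
      refine ⟨v 1, v 2, hPW v hv, ?_⟩
      funext l
      fin_cases l
      · simp [hv'.2.1]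
      · simp
      · simp
    refine (Finset.card_le_card hsub).trans (Finset.card_biUnion_le.trans ?_)
    exact Finset.sum_le_sum fun s _ => Finset.card_image_le
  -- Step 2: the degenerate values of `s`
  set D := Finset.univ.filter fun s : ZMod p => c2 s = 0 ∧ c1 s = 0 ∧ c0 s = 0 with hD
  have hDcard : #D ≤ 1 := by
    refine Finset.card_le_one.mpr fun a ha b hb => ?_
    rw [hD, Finset.mem_filter] at ha hb
    obtain ⟨-, ha2, ha1, -⟩ := ha
    obtain ⟨-, -, hb1, -⟩ := hb
    simp only [c2, c1] at ha2 ha1 hb1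
    by_cases h12 : A 1 2 = 0
    · exfalso
      have h02 : A 0 2 = 0 := by
        rw [h12] at ha1
        have : (2 : ZMod p) * A 0 2 = 0 := by linear_combination ha1
        rcases mul_eq_zero.mp this with h | h
        · exact absurd h h2
        · exact h
      apply hdet
      rw [Matrix.det_fin_three, h20, h21, h02, h12, ha2]
      ring
    · have : (2 * A 1 2) * (a - b) = 0 := by linear_combination ha1 - hb1
      rcases mul_eq_zero.mp this with h | h
      · rcases mul_eq_zero.mp h with h' | h'
        · exact absurd h' h2
        · exact absurd h' h12
      · exact sub_eq_zero.mp h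
  -- Step 3: sum over `s`
  have hT_le_p : ∀ s, #(Tset s) ≤ p := fun s =>
    (Finset.card_filter_le _ _).trans (by rw [Finset.card_univ, ZMod.card])
  have hT_le_2 : ∀ s, s ∉ D → #(Tset s) ≤ 2 := by
    intro s hs
    rw [hD, Finset.mem_filter, not_and] at hs
    exact card_quadratic_roots_le_two _ _ _ _ (hs (Finset.mem_univ s))
  have hsum : ∑ s, #(Tset s) ≤ 3 * p := by
    rw [← Finset.sum_filter_add_sum_filter_not Finset.univ (fun s => s ∈ D)]
    have hA1 : ∑ s ∈ Finset.univ.filter (fun s => s ∈ D), #(Tset s) ≤ 1 * p := by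
      calc ∑ s ∈ Finset.univ.filter (fun s => s ∈ D), #(Tset s)
          ≤ ∑ _s ∈ Finset.univ.filter (fun s => s ∈ D), p := Finset.sum_le_sum fun s _ => hT_le_p s
        _ = #(Finset.univ.filter (fun s => s ∈ D)) * p := by rw [Finset.sum_const, smul_eq_mul]
        _ ≤ 1 * p := by
            gcongr
            calc #(Finset.univ.filter (fun s : ZMod p => s ∈ D)) ≤ #D :=
                  Finset.card_le_card fun s hs => (Finset.mem_filter.mp hs).2
              _ ≤ 1 := hDcard
    have hA2 : ∑ s ∈ Finset.univ.filter (fun s => ¬ s ∈ D), #(Tset s) ≤ p * 2 := by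
      calc ∑ s ∈ Finset.univ.filter (fun s => ¬ s ∈ D), #(Tset s)
          ≤ ∑ _s ∈ Finset.univ.filter (fun s => ¬ s ∈ D), 2 :=
            Finset.sum_le_sum fun s hs => hT_le_2 s (Finset.mem_filter.mp hs).2
        _ = #(Finset.univ.filter (fun s => ¬ s ∈ D)) * 2 := by rw [Finset.sum_const, smul_eq_mul]
        _ ≤ p * 2 := by
            gcongr
            exact (Finset.card_filter_le _ _).trans (by rw [Finset.card_univ, ZMod.card])
    linarith
  exact hstep1.trans hsum

/-- `card_cls_zero_le` for an arbitrary pivot coordinate. [folklore] -/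
theorem card_cls_le {p : ℕ} [Fact p.Prime] (hp2 : p ≠ 2) (A : Matrix (Fin 3) (Fin 3) (ZMod p))
    (hA : A.IsSymm) (hdet : A.det ≠ 0) (i : Fin 3) :
    #{v : Fin 3 → ZMod p | v i = 1 ∧ v ⬝ᵥ A *ᵥ v = 0} ≤ 3 * p := by
  classical
  set σ : Equiv.Perm (Fin 3) := Equiv.swap 0 i with hσ
  have hσ0 : σ 0 = i := by simp [hσ, Equiv.swap_apply_left]
  have h := card_cls_zero_le hp2 (A.submatrix σ σ) (hA.submatrix σ)
    (by rw [Matrix.det_submatrix_equiv_self]; exact hdet)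
  refine le_trans ?_ h
  refine Finset.card_le_card_of_injOn (fun v => v ∘ σ) (fun v hv => ?_)
    (fun v _ v' _ hvv' => comp_perm_injective' σ hvv')
  simp only [Finset.coe_filter, Finset.mem_univ, true_and, Set.mem_setOf_eq] at hv ⊢
  exact ⟨by simpa [hσ0] using hv.1, by rw [comp_dot_submatrix_mulVec]; exact hv.2⟩

/-- The classes `(i, v)`, `v i = 1`, `v` on the conic modulo `p`: at most `9p`. [folklore] -/
theorem card_clsSet_le {p : ℕ} [Fact p.Prime] (hp2 : p ≠ 2) (A : Matrix (Fin 3) (Fin 3) (ZMod p))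
    (hA : A.IsSymm) (hdet : A.det ≠ 0) :
    #{q : Fin 3 × (Fin 3 → ZMod p) | q.2 q.1 = 1 ∧ q.2 ⬝ᵥ A *ᵥ q.2 = 0} ≤ 3 * (3 * p) := by
  classical
  have hsub : (Finset.univ.filter fun q : Fin 3 × (Fin 3 → ZMod p) =>
      q.2 q.1 = 1 ∧ q.2 ⬝ᵥ A *ᵥ q.2 = 0) ⊆
      Finset.univ.biUnion fun i : Fin 3 => (Finset.univ.filter fun v : Fin 3 → ZMod p =>
        v i = 1 ∧ v ⬝ᵥ A *ᵥ v = 0).image fun v => (i, v) := by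
    rintro ⟨i, v⟩ hq
    simp only [Finset.mem_filter, Finset.mem_univ, true_and] at hq
    simp only [Finset.mem_biUnion, Finset.mem_univ, Finset.mem_image, Finset.mem_filter, true_and,
      Prod.mk.injEq]
    exact ⟨i, v, hq, rfl, rfl⟩
  refine (Finset.card_le_card hsub).trans ((Finset.card_biUnion_le).trans ?_)
  calc ∑ i : Fin 3, #((Finset.univ.filter fun v : Fin 3 → ZMod p =>
          v i = 1 ∧ v ⬝ᵥ A *ᵥ v = 0).image fun v => (i, v))
      ≤ ∑ _i : Fin 3, 3 * p :=
        Finset.sum_le_sum fun i _ => Finset.card_image_le.trans (card_cls_le hp2 A hA hdet i)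
    _ = 3 * (3 * p) := by simp

end TernaryConic

end Literature.NumberTheory.DiophantineGeometry
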